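import Mathlib
import Literature.Analysis.UnboundedOperators.ConjugateOperatorRegularity
import Literature.Analysis.UnboundedOperators.UnitaryGroupGenerator
import HarnessLib
import Summits.AtomisticToContinuum.FouriersLaw.Theorems.EmbeddedDrudeMourreMourreDissolutionLAPDissipativeResolventDeriv
import Summits.AtomisticToContinuum.FouriersLaw.Theorems.EmbeddedDrudeMourreMourreDissolutionLAPResolventRegularity
import Summits.AtomisticToContinuum.FouriersLaw.Theorems.EmbeddedDrudeMourreMourreDissolutionLAPVirial

/-!
# Stub `stub_mourreThresholdLAP` — F3b (part 1/2): the commutator expansion of Mourre's dissipative resolvent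

Item `stmt-AtomisticToContinuum-12594` (crux `MourreDissolution` of route `EmbeddedDrudeMourre`,
sub-problem `FouriersLaw`), line `separable-vertex-faddeev-pair-sector`, stub S6
`stub_mourreThresholdLAP` (Mourre's limiting absorption principle, `C²` form), helper F3b of the
proof map (Mourre 1981; ABG = Amrein–Boutet de Monvel–Georgescu 1996, Lemma 7.3.4, here for
unbounded `H` through its bounded resolvent), part 1/2 (pure `C¹(A)` algebra; the matrix-element
bounds are in `…LAPCommutatorExpansionError`).

Setting (all bounded operators, notation of `…LAPDissipativeResolvent{,Identities,Deriv}`):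
`U(t) = e^{itH}` and `W(x) = e^{iAx}` one-parameter unitary groups, `R(z) = resolventAt U z`,
`C_R = [R(z), iA] = A.commutatorCLM (R z)`, a bounded DISSIPATIVE `M` (`0 ≤ Re ⟪f, M f⟫`) of class
`C¹(A; H)` with `M₁ = [M, iA]`, a real `ε` and a non-real `z` with `ε · Im z ≤ 0`,
`K = 1 + iε M R(z)`, `Kinv = K⁻¹`, `K̃inv = (1 + iε R(z) M)⁻¹ = 1 - iε G M`,
`G = mourreG U M ε z = R(z) Kinv = K̃inv R(z)` ("`(H - z + iεM)⁻¹`").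

* §1 `K`, `Kinv`, `G ∈ C¹(A; H)` and THE COMMUTATOR EXPANSION (ABG (7.3.8) in bounded form)
  `[G, iA] = K̃inv [R(z), iA] Kinv - iε G [M, iA] G`
  (Leibniz on `G = R Kinv`, the inverse rule on `K`, `[K, iA] = iε([M, iA] R + M [R, iA])`, and
  the push-through identities `R Kinv = G`, `1 - iε G M = K̃inv`; formally
  `[G, iA] = -G [H - z + iεM, iA] G = -G[H, iA]G - iε G[M, iA]G` with `-G[H, iA]G = K̃inv [R, iA] Kinv`);
* §2 THE MAIN-TERM IDENTITY: if `M = -X [R(z), iA] X` with `R X = X R = Φ` (for the Mourre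
  commutator this is `mourreCommutator_eq_neg_energyShift_mul` of `…LAPMourreCommutatorForm`,
  `X = Φ₁ - zΦ`), then `G M G = -K̃inv Φ [R, iA] Φ Kinv`, and THE ERROR DECOMPOSITION
  `G M G = -[G, iA] - iε G [M, iA] G + D`, `D = K̃inv ((1 - Φ) C_R + Φ C_R (1 - Φ)) Kinv`;
* §3 THE `z₀`-TRICK: with `V = 1 + (z - z₀) R(z)`, `[R(z), iA] = V [R(z₀), iA] V`,
  `V Kinv = Kinv + (z - z₀) G`, `K̃inv V = K̃inv + (z - z₀) G`, `Φ V = V Φ`;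
* §4 THE GENERIC MATRIX-ELEMENT BOUND `|⟪f, [S, iA] f⟫| ≤ ‖𝒜 f‖ (‖S f‖ + ‖S† f‖)` for `f ∈ D(A)`
  (`[S, iA] f = S (𝒜 f) - 𝒜 (S f)` and skew-symmetry of the generator `𝒜 = iA`).
-/

noncomputable section

open MeasureTheory Complex Filter Topology Set
open scoped InnerProductSpace ComplexConjugate ENNReal NNReal

namespace Summit.AtomisticToContinuum.FouriersLaw.Theorems.MourreDissolution

open Literature.Analysis.UnboundedOperators
open Literature.Analysis.UnboundedOperators.UnitaryRep

variable {H : Type*} [NormedAddCommGroup H] [InnerProductSpace ℂ H] [CompleteSpace H]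

/-! ## §1. `K`, `Kinv`, `G` are of class `C¹(A; H)`; the commutator expansion -/

/-- **`[K, iA] = iε ([M, iA] R(z) + M [R(z), iA])`** for `K = 1 + iε M R(z)` (Leibniz).
[cite: AmreinBoutetdeMonvelGeorgescu1996, Prop. 5.1.5] -/
theorem hasCommutator_mourreK {A U : OneParameterUnitaryGroup H} {M M₁ C : H →L[ℂ] H}
    (hM : A.HasCommutator M M₁) {z : ℂ} (hR : A.HasCommutator (resolventAt U z) C) (ε : ℝ) :
    A.HasCommutator (mourreK U M ε z) (((I : ℂ) * ε) • (M₁ * resolventAt U z + M * C)) := by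
  have h := (A.hasCommutator_one).add ((hM.mul hR).smul ((I : ℂ) * ε))
  rw [zero_add] at h
  exact h

/-- `K = 1 + iε M R(z) ∈ C¹(A; H)` when `M, R(z) ∈ C¹(A; H)`.
[cite: AmreinBoutetdeMonvelGeorgescu1996, Prop. 5.1.5] -/
theorem isOfClassC1_mourreK {A U : OneParameterUnitaryGroup H} {M : H →L[ℂ] H}
    (hM : A.IsOfClassC1 M) {z : ℂ} (hR : A.IsOfClassC1 (resolventAt U z)) (ε : ℝ) :
    A.IsOfClassC1 (mourreK U M ε z) :=
  (hasCommutator_mourreK hM.hasCommutator hR.hasCommutator ε).isOfClassC1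

/-- **`[Kinv, iA] = -Kinv [K, iA] Kinv`** (inverse rule; `K` is invertible for dissipative `M` and
`ε · Im z ≤ 0`). [cite: AmreinBoutetdeMonvelGeorgescu1996, Prop. 5.1.6] -/
theorem hasCommutator_mourreKinv {A U : OneParameterUnitaryGroup H} {M M₁ C : H →L[ℂ] H}
    (hMpos : ∀ f : H, 0 ≤ (⟪f, M f⟫_ℂ).re) {z : ℂ} (hz : z.im ≠ 0) {ε : ℝ} (hεz : ε * z.im ≤ 0)
    (hM : A.HasCommutator M M₁) (hR : A.HasCommutator (resolventAt U z) C) :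
    A.HasCommutator (mourreKinv U M ε z)
      (-(mourreKinv U M ε z * (((I : ℂ) * ε) • (M₁ * resolventAt U z + M * C)) *
        mourreKinv U M ε z)) :=
  hasCommutator_inverse (hasCommutator_mourreK hM hR ε) (mourreK_mul_mourreKinv hMpos hz hεz U)
    (mourreKinv_mul_mourreK hMpos hz hεz U)

/-- `Kinv ∈ C¹(A; H)`. [cite: AmreinBoutetdeMonvelGeorgescu1996, Prop. 5.1.6] -/
theorem isOfClassC1_mourreKinv {A U : OneParameterUnitaryGroup H} {M : H →L[ℂ] H}
    (hMpos : ∀ f : H, 0 ≤ (⟪f, M f⟫_ℂ).re) {z : ℂ} (hz : z.im ≠ 0) {ε : ℝ} (hεz : ε * z.im ≤ 0)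
    (hM : A.IsOfClassC1 M) (hR : A.IsOfClassC1 (resolventAt U z)) :
    A.IsOfClassC1 (mourreKinv U M ε z) :=
  (hasCommutator_mourreKinv hMpos hz hεz hM.hasCommutator hR.hasCommutator).isOfClassC1

/-- The regrouping behind the commutator expansion:
`C Kinv - R Kinv (iε([M,iA] R + M C)) Kinv = (1 - iε G M) C Kinv - iε G [M,iA] G`. [folklore] -/
theorem mourreG_commutator_regroup {U : OneParameterUnitaryGroup H} {M : H →L[ℂ] H}
    (hMpos : ∀ f : H, 0 ≤ (⟪f, M f⟫_ℂ).re) {z : ℂ} (hz : z.im ≠ 0) {ε : ℝ} (hεz : ε * z.im ≤ 0)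
    (M₁ C : H →L[ℂ] H) :
    C * mourreKinv U M ε z + resolventAt U z *
        -(mourreKinv U M ε z * (((I : ℂ) * ε) • (M₁ * resolventAt U z + M * C)) *
          mourreKinv U M ε z) =
      mourreKtinv U M ε z * C * mourreKinv U M ε z -
        ((I : ℂ) * ε) • (mourreG U M ε z * M₁ * mourreG U M ε z) := by
  rw [mourreKtinv_eq hMpos hz hεz U, mourreG]
  simp only [mul_add, add_mul, sub_mul, one_mul, mul_neg, smul_mul_assoc, mul_smul_comm, smul_add,
    mul_assoc]
  abel

/-- **The commutator expansion of Mourre's dissipative resolvent** (ABG (7.3.8), bounded form):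
`x ↦ 𝒲(x)[G]` has strong derivative `[G, iA] = K̃inv C Kinv - iε G M₁ G` at `0`, where
`C = [R(z), iA]`, `M₁ = [M, iA]` (Leibniz on `G = R(z) Kinv` and the inverse rule on `K`; formally
`[G, iA] = -G[H, iA]G - iε G[M, iA]G` with `-G[H, iA]G = K̃inv [R(z), iA] Kinv`).
[cite: AmreinBoutetdeMonvelGeorgescu1996, Lemma 7.3.4] -/
theorem hasCommutator_mourreG {A U : OneParameterUnitaryGroup H} {M M₁ C : H →L[ℂ] H}
    (hMpos : ∀ f : H, 0 ≤ (⟪f, M f⟫_ℂ).re) {z : ℂ} (hz : z.im ≠ 0) {ε : ℝ} (hεz : ε * z.im ≤ 0)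
    (hM : A.HasCommutator M M₁) (hR : A.HasCommutator (resolventAt U z) C) :
    A.HasCommutator (mourreG U M ε z)
      (mourreKtinv U M ε z * C * mourreKinv U M ε z -
        ((I : ℂ) * ε) • (mourreG U M ε z * M₁ * mourreG U M ε z)) := by
  have h := hR.mul (hasCommutator_mourreKinv hMpos hz hεz hM hR)
  rw [mourreG_commutator_regroup hMpos hz hεz M₁ C] at h
  exact h

/-- **`G ∈ C¹(A; H)`.** [cite: AmreinBoutetdeMonvelGeorgescu1996, Lemma 7.3.4] -/
theorem isOfClassC1_mourreG {A U : OneParameterUnitaryGroup H} {M : H →L[ℂ] H}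
    (hMpos : ∀ f : H, 0 ≤ (⟪f, M f⟫_ℂ).re) {z : ℂ} (hz : z.im ≠ 0) {ε : ℝ} (hεz : ε * z.im ≤ 0)
    (hM : A.IsOfClassC1 M) (hR : A.IsOfClassC1 (resolventAt U z)) :
    A.IsOfClassC1 (mourreG U M ε z) :=
  (hasCommutator_mourreG hMpos hz hεz hM.hasCommutator hR.hasCommutator).isOfClassC1

/-- **`[G, iA] = K̃inv [R(z), iA] Kinv - iε G [M, iA] G`** (the commutator expansion at the level of
`commutatorCLM`). [cite: AmreinBoutetdeMonvelGeorgescu1996, Lemma 7.3.4] -/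
theorem commutatorCLM_mourreG {A U : OneParameterUnitaryGroup H} {M : H →L[ℂ] H}
    (hMpos : ∀ f : H, 0 ≤ (⟪f, M f⟫_ℂ).re) {z : ℂ} (hz : z.im ≠ 0) {ε : ℝ} (hεz : ε * z.im ≤ 0)
    (hM : A.IsOfClassC1 M) (hR : A.IsOfClassC1 (resolventAt U z)) :
    A.commutatorCLM (mourreG U M ε z) =
      mourreKtinv U M ε z * A.commutatorCLM (resolventAt U z) * mourreKinv U M ε z -
        ((I : ℂ) * ε) • (mourreG U M ε z * A.commutatorCLM M * mourreG U M ε z) :=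
  (hasCommutator_mourreG hMpos hz hεz hM.hasCommutator hR.hasCommutator).commutatorCLM_eq

/-- The sandwiched resolvent commutator in terms of `[G, iA]`:
`K̃inv [R(z), iA] Kinv = [G, iA] + iε G [M, iA] G`. [cite: AmreinBoutetdeMonvelGeorgescu1996, Lemma 7.3.4] -/
theorem mourreKtinv_mul_commutatorCLM_mul_mourreKinv {A U : OneParameterUnitaryGroup H}
    {M : H →L[ℂ] H} (hMpos : ∀ f : H, 0 ≤ (⟪f, M f⟫_ℂ).re) {z : ℂ} (hz : z.im ≠ 0) {ε : ℝ}
    (hεz : ε * z.im ≤ 0) (hM : A.IsOfClassC1 M) (hR : A.IsOfClassC1 (resolventAt U z)) :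
    mourreKtinv U M ε z * A.commutatorCLM (resolventAt U z) * mourreKinv U M ε z =
      A.commutatorCLM (mourreG U M ε z) +
        ((I : ℂ) * ε) • (mourreG U M ε z * A.commutatorCLM M * mourreG U M ε z) := by
  rw [commutatorCLM_mourreG hMpos hz hεz hM hR, sub_add_cancel]

/-- Under the stub's hypothesis `H ∈ C¹(A)` (`HamiltonianOfClassC1`): `G_ε(z) ∈ C¹(A; H)` for every
non-real `z` on the admissible side. [cite: AmreinBoutetdeMonvelGeorgescu1996, Lemma 7.3.4] -/
theorem isOfClassC1_mourreG_of_hamiltonianOfClassC1 {A U : OneParameterUnitaryGroup H}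
    (hH : U.HamiltonianOfClassC1 A) {M : H →L[ℂ] H} (hMpos : ∀ f : H, 0 ≤ (⟪f, M f⟫_ℂ).re)
    (hM : A.IsOfClassC1 M) {z : ℂ} (hz : z.im ≠ 0) {ε : ℝ} (hεz : ε * z.im ≤ 0) :
    A.IsOfClassC1 (mourreG U M ε z) :=
  isOfClassC1_mourreG hMpos hz hεz hM (isOfClassC1_resolventAt hH hz)

/-! ## §2. The main-term identity and the error decomposition -/

/-- **Main-term identity**: if `M = -X C X` with `R(z) X = X R(z) = Φ`, then
`G M G = -K̃inv Φ C Φ Kinv` (`G = K̃inv R = R Kinv`). For the Mourre commutator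
`M = φ(H)[H, iA]φ(H)` this is `C = [R(z), iA]`, `X = Φ₁ - zΦ`, `Φ = φ(H)`
(`mourreCommutator_eq_neg_energyShift_mul`). [cite: AmreinBoutetdeMonvelGeorgescu1996, Lemma 7.3.4] -/
theorem mourreG_mul_mul_mourreG_eq_neg {U : OneParameterUnitaryGroup H} {M : H →L[ℂ] H}
    (hMpos : ∀ f : H, 0 ≤ (⟪f, M f⟫_ℂ).re) {z : ℂ} (hz : z.im ≠ 0) {ε : ℝ} (hεz : ε * z.im ≤ 0)
    {X Φ C : H →L[ℂ] H} (hRX : resolventAt U z * X = Φ) (hXR : X * resolventAt U z = Φ)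
    (hMX : M = -(X * C * X)) :
    mourreG U M ε z * M * mourreG U M ε z =
      -(mourreKtinv U M ε z * Φ * C * Φ * mourreKinv U M ε z) := by
  have hG : mourreG U M ε z = mourreKtinv U M ε z * resolventAt U z :=
    mourreG_eq_mourreKtinv_mul hMpos hz hεz U
  calc mourreG U M ε z * M * mourreG U M ε z
      = mourreKtinv U M ε z * resolventAt U z * -(X * C * X) *
          (resolventAt U z * mourreKinv U M ε z) := by rw [← hMX, ← hG]; rfl
    _ = -(mourreKtinv U M ε z * (resolventAt U z * X) * C * (X * resolventAt U z) *
          mourreKinv U M ε z) := by simp only [mul_neg, neg_mul, mul_assoc]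
    _ = _ := by rw [hRX, hXR]

omit [CompleteSpace H] in
/-- `(1 - Φ) C + Φ C (1 - Φ) = C - Φ C Φ`. [folklore] -/
theorem one_sub_mul_add_mul_mul_one_sub (Φ C : H →L[ℂ] H) :
    (1 - Φ) * C + Φ * C * (1 - Φ) = C - Φ * C * Φ := by
  simp only [sub_mul, mul_sub, one_mul, mul_one]
  abel

/-- **The error decomposition** (ABG (7.3.8)–(7.3.10) in bounded form): under the `M`-identity
`M = -X [R(z), iA] X`, `R X = X R = Φ`, with `C_R = [R(z), iA]`, `M₁ = [M, iA]`,
`G M G = -[G, iA] - iε G M₁ G + K̃inv ((1 - Φ) C_R + Φ C_R (1 - Φ)) Kinv`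
(main term `-K̃inv Φ C_R Φ Kinv = -K̃inv C_R Kinv + D` and `K̃inv C_R Kinv = [G, iA] + iε G M₁ G`).
[cite: AmreinBoutetdeMonvelGeorgescu1996, Lemma 7.3.4] -/
theorem mourreG_mul_mul_mourreG_eq_expansion {A U : OneParameterUnitaryGroup H} {M : H →L[ℂ] H}
    (hMpos : ∀ f : H, 0 ≤ (⟪f, M f⟫_ℂ).re) {z : ℂ} (hz : z.im ≠ 0) {ε : ℝ} (hεz : ε * z.im ≤ 0)
    (hM : A.IsOfClassC1 M) (hR : A.IsOfClassC1 (resolventAt U z)) {X Φ : H →L[ℂ] H}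
    (hRX : resolventAt U z * X = Φ) (hXR : X * resolventAt U z = Φ)
    (hMX : M = -(X * A.commutatorCLM (resolventAt U z) * X)) :
    mourreG U M ε z * M * mourreG U M ε z =
      -A.commutatorCLM (mourreG U M ε z) -
          ((I : ℂ) * ε) • (mourreG U M ε z * A.commutatorCLM M * mourreG U M ε z) +
        mourreKtinv U M ε z *
            ((1 - Φ) * A.commutatorCLM (resolventAt U z) +
              Φ * A.commutatorCLM (resolventAt U z) * (1 - Φ)) *
          mourreKinv U M ε z := by
  rw [mourreG_mul_mul_mourreG_eq_neg hMpos hz hεz hRX hXR hMX, one_sub_mul_add_mul_mul_one_sub,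
    commutatorCLM_mourreG hMpos hz hεz hM hR]
  simp only [mul_sub, sub_mul, neg_sub, mul_assoc]
  abel

/-! ## §3. The `z₀`-trick -/

/-- **`[R(z), iA] = V [R(z₀), iA] V`** with `V = 1 + (z - z₀) R(z)`, whenever `R(z₀) ∈ C¹(A; H)`
(first resolvent identity, Leibniz and inverse rules: `hasCommutator_resolventAt_of_hasCommutator`).
[cite: AmreinBoutetdeMonvelGeorgescu1996, Lemma 6.2.1] -/
theorem commutatorCLM_resolventAt_eq_transition {A U : OneParameterUnitaryGroup H} {z z₀ : ℂ}
    (hz : z.im ≠ 0) (hz₀ : z₀.im ≠ 0) (h₀ : A.IsOfClassC1 (resolventAt U z₀)) :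
    A.commutatorCLM (resolventAt U z) =
      (1 + (z - z₀) • resolventAt U z) * A.commutatorCLM (resolventAt U z₀) *
        (1 + (z - z₀) • resolventAt U z) :=
  (hasCommutator_resolventAt_of_hasCommutator hz hz₀ h₀.hasCommutator).commutatorCLM_eq

/-- **`V Kinv = Kinv + (z - z₀) G`** (`R Kinv = G`). [folklore] -/
theorem transition_mul_mourreKinv (U : OneParameterUnitaryGroup H) (M : H →L[ℂ] H) (ε : ℝ)
    (z z₀ : ℂ) :
    (1 + (z - z₀) • resolventAt U z) * mourreKinv U M ε z =
      mourreKinv U M ε z + (z - z₀) • mourreG U M ε z := by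
  rw [add_mul, one_mul, smul_mul_assoc, mourreG]

/-- **`K̃inv V = K̃inv + (z - z₀) G`** (`K̃inv R = G`). [folklore] -/
theorem mourreKtinv_mul_transition {U : OneParameterUnitaryGroup H} {M : H →L[ℂ] H}
    (hMpos : ∀ f : H, 0 ≤ (⟪f, M f⟫_ℂ).re) {z : ℂ} (hz : z.im ≠ 0) {ε : ℝ} (hεz : ε * z.im ≤ 0)
    (z₀ : ℂ) :
    mourreKtinv U M ε z * (1 + (z - z₀) • resolventAt U z) =
      mourreKtinv U M ε z + (z - z₀) • mourreG U M ε z := by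
  rw [mul_add, mul_one, mul_smul_comm, ← mourreG_eq_mourreKtinv_mul hMpos hz hεz U]

/-- **`Φ V = V Φ`** for every `Φ` commuting with `R(z)` (e.g. `Φ = φ(H)`,
`fourierCalculus_resolventAt_comm`). [folklore] -/
theorem mul_transition_comm {U : OneParameterUnitaryGroup H} {Φ : H →L[ℂ] H} {z : ℂ}
    (hΦ : Φ * resolventAt U z = resolventAt U z * Φ) (c : ℂ) :
    Φ * (1 + c • resolventAt U z) = (1 + c • resolventAt U z) * Φ := by
  rw [mul_add, add_mul, mul_one, one_mul, mul_smul_comm, smul_mul_assoc, hΦ]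

/-! ## §4. The generic matrix-element bound `|⟪f, [S, iA] f⟫| ≤ ‖𝒜 f‖ (‖S f‖ + ‖S† f‖)` -/

/-- **`|⟪f, [S, iA] f⟫| ≤ ‖𝒜 f‖ (‖S f‖ + ‖S† f‖)` for `f ∈ D(A)`**, where `𝒜` is the generator of
`x ↦ e^{iAx}` (`= iA`): `[S, iA] f = S (𝒜 f) - 𝒜 (S f)` (`HasCommutator.apply_eq`, with
`S f ∈ D(A)` by `apply_mem_generator_domain_of_hasCommutator`) and `⟪f, 𝒜 (S f)⟫ = -⟪𝒜 f, S f⟫`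
(skew-symmetry of the generator). [cite: AmreinBoutetdeMonvelGeorgescu1996, §5.1 eq. (5.1.4)] -/
theorem norm_inner_commutator_le_of_mem_domain (A : OneParameterUnitaryGroup H) {S D : H →L[ℂ] H}
    (h : A.HasCommutator S D) {f : H}
    (hf : f ∈ (OneParameterGroup.generator A.toStrongContRepresentation).domain) :
    ‖⟪f, D f⟫_ℂ‖ ≤ ‖OneParameterGroup.generator A.toStrongContRepresentation ⟨f, hf⟩‖ *
      (‖S f‖ + ‖ContinuousLinearMap.adjoint S f‖) := by
  obtain ⟨hSf, -⟩ := apply_mem_generator_domain_of_hasCommutator A h hf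
  set gen := OneParameterGroup.generator A.toStrongContRepresentation with hgen
  have hskew : ⟪f, gen ⟨S f, hSf⟩⟫_ℂ = -⟪gen ⟨f, hf⟩, S f⟫_ℂ := by
    have := inner_generator_eq_neg A ⟨f, hf⟩ ⟨S f, hSf⟩
    rw [this, neg_neg]
  rw [h.apply_eq hf hSf, inner_sub_right, hskew, sub_neg_eq_add,
    ← ContinuousLinearMap.adjoint_inner_left]
  calc ‖⟪ContinuousLinearMap.adjoint S f, gen ⟨f, hf⟩⟫_ℂ + ⟪gen ⟨f, hf⟩, S f⟫_ℂ‖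
      ≤ ‖⟪ContinuousLinearMap.adjoint S f, gen ⟨f, hf⟩⟫_ℂ‖ + ‖⟪gen ⟨f, hf⟩, S f⟫_ℂ‖ :=
        norm_add_le _ _
    _ ≤ ‖ContinuousLinearMap.adjoint S f‖ * ‖gen ⟨f, hf⟩‖ + ‖gen ⟨f, hf⟩‖ * ‖S f‖ :=
        add_le_add (norm_inner_le_norm _ _) (norm_inner_le_norm _ _)
    _ = ‖gen ⟨f, hf⟩‖ * (‖S f‖ + ‖ContinuousLinearMap.adjoint S f‖) := by ring

/-- The same bound phrased with the Stone Hamiltonian `A.hamiltonian = -i𝒜` of the conjugate group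
(`‖A.hamiltonian f‖ = ‖𝒜 f‖`), the form in which `ψ ∈ D(A)` enters the stub:
`|⟪f, [S, iA] f⟫| ≤ ‖A f‖ (‖S f‖ + ‖S† f‖)`. [cite: AmreinBoutetdeMonvelGeorgescu1996, §5.1 eq. (5.1.4)] -/
theorem norm_inner_commutator_le_of_mem_hamiltonian_domain (A : OneParameterUnitaryGroup H)
    {S D : H →L[ℂ] H} (h : A.HasCommutator S D) {f : H} (hf : f ∈ A.hamiltonian.domain) :
    ‖⟪f, D f⟫_ℂ‖ ≤ ‖A.hamiltonian ⟨f, hf⟩‖ * (‖S f‖ + ‖ContinuousLinearMap.adjoint S f‖) := by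
  have hf' : f ∈ (OneParameterGroup.generator A.toStrongContRepresentation).domain := by
    rw [hamiltonian_domain] at hf; exact hf
  have hn : ‖A.hamiltonian ⟨f, hf⟩‖ =
      ‖OneParameterGroup.generator A.toStrongContRepresentation ⟨f, hf'⟩‖ := by
    rw [hamiltonian_apply, norm_smul, norm_neg, Complex.norm_I, one_mul]
    rfl
  rw [hn]
  exact norm_inner_commutator_le_of_mem_domain A h hf'

/-- **`|⟪f, [G, iA] f⟫| ≤ ‖A f‖ (‖G f‖ + ‖G† f‖)` for `f ∈ D(A)`** (the generic bound at `S = G`).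
[cite: AmreinBoutetdeMonvelGeorgescu1996, Lemma 7.3.4] -/
theorem norm_inner_commutatorCLM_mourreG_le {A U : OneParameterUnitaryGroup H} {M : H →L[ℂ] H}
    (hMpos : ∀ f : H, 0 ≤ (⟪f, M f⟫_ℂ).re) {z : ℂ} (hz : z.im ≠ 0) {ε : ℝ} (hεz : ε * z.im ≤ 0)
    (hM : A.IsOfClassC1 M) (hR : A.IsOfClassC1 (resolventAt U z)) {f : H}
    (hf : f ∈ A.hamiltonian.domain) :
    ‖⟪f, A.commutatorCLM (mourreG U M ε z) f⟫_ℂ‖ ≤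
      ‖A.hamiltonian ⟨f, hf⟩‖ *
        (‖mourreG U M ε z f‖ + ‖ContinuousLinearMap.adjoint (mourreG U M ε z) f‖) :=
  norm_inner_commutator_le_of_mem_hamiltonian_domain A
    (isOfClassC1_mourreG hMpos hz hεz hM hR).hasCommutator hf

/-! ## §5. Headline (registered helper stub) -/

/-- **The commutator expansion of Mourre's dissipative resolvent, headline form** (all binders
explicit; registered helper stub of `stub_mourreThresholdLAP`, S6-PLAN F3b): for dissipative
`M ∈ C¹(A; H)`, a real `ε` and a non-real `z` with `ε · Im z ≤ 0` and `R(z) ∈ C¹(A; H)`: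
(1) `G = G_ε(z) ∈ C¹(A; H)`; (2) `[G, iA] = K̃inv [R(z), iA] Kinv - iε G [M, iA] G`;
(3) under the `M`-identity `M = -X [R(z), iA] X` with `R X = X R = Φ`, the error decomposition
`G M G = -[G, iA] - iε G [M, iA] G + K̃inv ((1 - Φ)[R, iA] + Φ [R, iA] (1 - Φ)) Kinv`;
(4) `|⟪f, [G, iA] f⟫| ≤ ‖A f‖ (‖G f‖ + ‖G† f‖)` for `f ∈ D(A)`.
[cite: AmreinBoutetdeMonvelGeorgescu1996, Lemma 7.3.4] -/
theorem mourreG_commutator_expansion :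
    ∀ (K : Type) [NormedAddCommGroup K] [InnerProductSpace ℂ K] [CompleteSpace K]
      (U A : Literature.Analysis.UnboundedOperators.OneParameterUnitaryGroup K) (M : K →L[ℂ] K)
      (ε : ℝ) (z : ℂ), (∀ f : K, 0 ≤ (inner ℂ f (M f)).re) → z.im ≠ 0 → ε * z.im ≤ 0 →
      A.IsOfClassC1 M →
      A.IsOfClassC1 (Summit.AtomisticToContinuum.FouriersLaw.Theorems.MourreDissolution.resolventAt U z) →
        A.IsOfClassC1 (Summit.AtomisticToContinuum.FouriersLaw.Theorems.MourreDissolution.mourreG U M ε z) ∧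
        A.commutatorCLM (Summit.AtomisticToContinuum.FouriersLaw.Theorems.MourreDissolution.mourreG U M ε z) =
          Summit.AtomisticToContinuum.FouriersLaw.Theorems.MourreDissolution.mourreKtinv U M ε z *
              A.commutatorCLM
                (Summit.AtomisticToContinuum.FouriersLaw.Theorems.MourreDissolution.resolventAt U z) *
            Summit.AtomisticToContinuum.FouriersLaw.Theorems.MourreDissolution.mourreKinv U M ε z -
          (Complex.I * (ε : ℂ)) •
            (Summit.AtomisticToContinuum.FouriersLaw.Theorems.MourreDissolution.mourreG U M ε z *
                A.commutatorCLM M *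
              Summit.AtomisticToContinuum.FouriersLaw.Theorems.MourreDissolution.mourreG U M ε z) ∧
        (∀ X Φ : K →L[ℂ] K,
          Summit.AtomisticToContinuum.FouriersLaw.Theorems.MourreDissolution.resolventAt U z * X = Φ →
          X * Summit.AtomisticToContinuum.FouriersLaw.Theorems.MourreDissolution.resolventAt U z = Φ →
          M = -(X * A.commutatorCLM
              (Summit.AtomisticToContinuum.FouriersLaw.Theorems.MourreDissolution.resolventAt U z) * X) →
            Summit.AtomisticToContinuum.FouriersLaw.Theorems.MourreDissolution.mourreG U M ε z * M *
                Summit.AtomisticToContinuum.FouriersLaw.Theorems.MourreDissolution.mourreG U M ε z =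
              -A.commutatorCLM
                  (Summit.AtomisticToContinuum.FouriersLaw.Theorems.MourreDissolution.mourreG U M ε z) -
                (Complex.I * (ε : ℂ)) •
                  (Summit.AtomisticToContinuum.FouriersLaw.Theorems.MourreDissolution.mourreG U M ε z *
                      A.commutatorCLM M *
                    Summit.AtomisticToContinuum.FouriersLaw.Theorems.MourreDissolution.mourreG U M ε z) +
              Summit.AtomisticToContinuum.FouriersLaw.Theorems.MourreDissolution.mourreKtinv U M ε z *
                  ((1 - Φ) * A.commutatorCLM
                      (Summit.AtomisticToContinuum.FouriersLaw.Theorems.MourreDissolution.resolventAt U z) +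
                    Φ * A.commutatorCLM
                      (Summit.AtomisticToContinuum.FouriersLaw.Theorems.MourreDissolution.resolventAt U z) *
                      (1 - Φ)) *
                Summit.AtomisticToContinuum.FouriersLaw.Theorems.MourreDissolution.mourreKinv U M ε z) ∧
        ∀ (f : K) (hf : f ∈ A.hamiltonian.domain),
          ‖inner ℂ f (A.commutatorCLM
              (Summit.AtomisticToContinuum.FouriersLaw.Theorems.MourreDissolution.mourreG U M ε z) f)‖ ≤
            ‖A.hamiltonian ⟨f, hf⟩‖ *
              (‖Summit.AtomisticToContinuum.FouriersLaw.Theorems.MourreDissolution.mourreG U M ε z f‖ +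
                ‖ContinuousLinearMap.adjoint
                    (Summit.AtomisticToContinuum.FouriersLaw.Theorems.MourreDissolution.mourreG U M ε z) f‖) := by
  intro K _ _ _ U A M ε z hMpos hz hεz hM hR
  exact ⟨isOfClassC1_mourreG hMpos hz hεz hM hR, commutatorCLM_mourreG hMpos hz hεz hM hR,
    fun X Φ hRX hXR hMX => mourreG_mul_mul_mourreG_eq_expansion hMpos hz hεz hM hR hRX hXR hMX,
    fun f hf => norm_inner_commutatorCLM_mourreG_le hMpos hz hεz hM hR hf⟩

end Summit.AtomisticToContinuum.FouriersLaw.Theorems.MourreDissolution
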